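import Summits.CriticalPhenomena.PercolationContinuityZ3.Theorems.Transplant.Z3DiagonalSkeletonE1
import HarnessLib

/-!
# `𝕋 □ ℤ = Cay(ℤ³; ±e₀, ±e₁, ±e₂, ±(e₀+e₂))` carries NO `PlanarSkeletonConc` — for ANY skeleton map (refuter's row 24, part 2; the HEXAGON argument
# of `HOME/bschramm/P5-SHARPNESS.md` §22.9)

builds on p205010 (kernel theorem, internal audit signed; external expert review pending) — nothing in this file uses p205010.
Lane `prim-bschramm`, seat `prim-bschramm-p5` (gen 5; METHOD = counterexample / sharpness search); helper file (`--supports stmt-CriticalPhenomena-4575 --as helper`).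

Part 1 (`Z3DiagonalSkeletonE1`): at a base vertex `t` of a `PlanarSkeleton Φ` on `dgGraph`, `φ (t ± e₁) = φ t`.  Here: the lifted quarter-turn
`α = point t rot` permutes the six TRIANGULAR neighbours `t + hex i` (`hex = (e₀, e₀+e₂, e₂, −e₀, −e₀−e₂, −e₂)`, a 6-cycle: `hexAdj_iff`) as a
cycle automorphism `τ` (`τ` injective, adjacency-preserving); every automorphism of the 6-cycle is affine `i ↦ a ± i` (`cyc_aut_affine`), hence
satisfies `τ⁶ = id` (`cyc_aut_pow_six`); so `α⁶` fixes `t + s₀` for the `step` neighbour `s₀` with displacement `φ(t+s₀) − φ t = (1,0)`, while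
displacements transform by `rot` under `α` and `rot⁶ = rot² = −1`: `(1,0) = −(1,0)`, absurd.  Hence **`isEmpty_planarSkeletonConc_dgGraph`**:
the node of record `SamePDropOfSkeletonConcLt` cannot reach this Cayley graph of `ℤ³` through any skeleton (route D″ only, as for the decorated slab,
`DecoratedSlab.isEmpty_planarSkeletonConc`).  Bare `PlanarSkeleton`s on `dgGraph` DO exist (`φ ≡ 0`), so `IsEmpty` is the right statement.
[cite: KozmaNitzan2024, §4 p. 15–16 (the role of the lattice symmetries; Lemma 8)] [cite: BenjaminiSchramm1996, Conj. 4]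
-/

namespace Summit.CriticalPhenomena.PercolationContinuityZ3.Theorems.Transplant

namespace Z3Diag

open Literature.Probability.LatticeModels Literature.Probability.Percolation.GM SimpleGraph

/-! ## §1 The hexagon of triangular neighbours -/

/-- The six triangular generators in cyclic order. [folklore] -/
def hex : Fin 6 → Site 3 := ![ev 0, ev 0 + ev 2, ev 2, -ev 0, -(ev 0 + ev 2), -ev 2]

/-- A computable index on `Site 3` inverting `hex` on the hexagon. [folklore] -/
def idx (s : Site 3) : Fin 6 :=
  if s = hex 0 then 0 else if s = hex 1 then 1 else if s = hex 2 then 2 else if s = hex 3 then 3 else if s = hex 4 then 4 else 5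

/-- `idx ∘ hex = id`. [folklore] -/
theorem idx_hex : ∀ i : Fin 6, idx (hex i) = i := by decide

/-- `hex` is injective. [folklore] -/
theorem hex_injective : Function.Injective hex := fun i j h => by
  have := congrArg idx h; rwa [idx_hex, idx_hex] at this

/-- The hexagon consists of generators. [folklore] -/
theorem hex_mem : ∀ i : Fin 6, hex i ∈ dgGens := by decide

/-- Every generator other than `±e₁` is on the hexagon. [folklore] -/
theorem exists_hex_eq : ∀ d ∈ dgGens, d ≠ ev 1 → d ≠ -ev 1 → ∃ i : Fin 6, hex i = d := by decide

/-- Cyclic adjacency on `Fin 6`. [folklore] -/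
def cyc (i j : Fin 6) : Prop := j = i + 1 ∨ i = j + 1

/-- `cyc` is decidable. [folklore] -/
instance (i j : Fin 6) : Decidable (cyc i j) := inferInstanceAs (Decidable (_ ∨ _))

/-- **The triangular neighbours form the 6-cycle**: `t + hex i ∼ t + hex j ↔ cyc i j`. [folklore] -/
theorem hexAdj_iff : ∀ i j : Fin 6, hex j - hex i ∈ dgGens ↔ cyc i j := by decide

/-! ## §2 Automorphisms of the 6-cycle have exponent 6 -/

/-- `i + 1 + 1 ≠ i` in `Fin 6`. [folklore] -/
theorem fin6_add_two_ne : ∀ i : Fin 6, i + 1 + 1 ≠ i := by decide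

/-- **Rigidity of the 6-cycle**: an injective, adjacency-preserving self-map is affine, `τ j = τ 0 + δ j` with `δ = ±1`. [folklore] -/
theorem cyc_aut_affine {τ : Fin 6 → Fin 6} (hinj : Function.Injective τ) (hadj : ∀ i j, cyc i j → cyc (τ i) (τ j)) :
    ∃ δ : Fin 6, (δ = 1 ∨ δ = -1) ∧ ∀ j, τ j = τ 0 + δ * j := by
  -- each step is `±1`
  have hstep : ∀ i, τ (i + 1) = τ i + 1 ∨ τ (i + 1) = τ i - 1 := by
    intro i
    rcases hadj i (i + 1) (Or.inl rfl) with h | h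
    · exact Or.inl h
    · right; rw [h, add_sub_cancel_right]
  -- consecutive steps agree (else `τ (i+2) = τ i`)
  have hcons : ∀ i (δ : Fin 6), (δ = 1 ∨ δ = -1) → τ (i + 1) = τ i + δ → τ (i + 1 + 1) = τ (i + 1) + δ := by
    intro i δ hδ h
    rcases hδ with rfl | rfl
    · rcases hstep (i + 1) with h' | h'
      · exact h'
      · exfalso
        have : τ (i + 1 + 1) = τ i := by rw [h', h, add_sub_cancel_right]
        exact fin6_add_two_ne i (hinj this)
    · rcases hstep (i + 1) with h' | h'
      · exfalso
        have : τ (i + 1 + 1) = τ i := by rw [h', h, ← sub_eq_add_neg, sub_add_cancel]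
        exact fin6_add_two_ne i (hinj this)
      · rw [h', sub_eq_add_neg]
  -- the sign of the first step
  obtain ⟨δ, hδ, h0⟩ : ∃ δ : Fin 6, (δ = 1 ∨ δ = -1) ∧ τ (0 + 1) = τ 0 + δ := by
    rcases hstep 0 with h | h
    · exact ⟨1, Or.inl rfl, h⟩
    · exact ⟨-1, Or.inr rfl, by rw [h, sub_eq_add_neg]⟩
  refine ⟨δ, hδ, ?_⟩
  -- all steps have sign `δ` (unrolled along 0, 1, …, 5)
  have h1 : τ (0 + 1) = τ 0 + δ := h0
  have h2 := hcons _ δ hδ h1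
  have h3 := hcons _ δ hδ h2
  have h4 := hcons _ δ hδ h3
  have h5 := hcons _ δ hδ h4
  have hcases : ∀ j : Fin 6, j = 0 ∨ j = 0 + 1 ∨ j = 0 + 1 + 1 ∨ j = 0 + 1 + 1 + 1 ∨ j = 0 + 1 + 1 + 1 + 1 ∨ j = 0 + 1 + 1 + 1 + 1 + 1 := by
    decide
  have L1 : ∀ a d : Fin 6, a + d = a + d * (0 + 1) := by decide
  have L2 : ∀ a d : Fin 6, a + d + d = a + d * (0 + 1 + 1) := by decide
  have L3 : ∀ a d : Fin 6, a + d + d + d = a + d * (0 + 1 + 1 + 1) := by decide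
  have L4 : ∀ a d : Fin 6, a + d + d + d + d = a + d * (0 + 1 + 1 + 1 + 1) := by decide
  have L5 : ∀ a d : Fin 6, a + d + d + d + d + d = a + d * (0 + 1 + 1 + 1 + 1 + 1) := by decide
  intro j
  rcases hcases j with rfl | rfl | rfl | rfl | rfl | rfl
  · rw [mul_zero, add_zero]
  · rw [h1]; exact L1 _ _
  · rw [h2, h1]; exact L2 _ _
  · rw [h3, h2, h1]; exact L3 _ _
  · rw [h4, h3, h2, h1]; exact L4 _ _
  · rw [h5, h4, h3, h2, h1]; exact L5 _ _

/-- Affine maps of `Fin 6` with slope `±1` have sixth iterate the identity (`D₆` has exponent 6). [folklore] -/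
theorem affine_pow_six : ∀ a δ : Fin 6, (δ = 1 ∨ δ = -1) → ∀ i : Fin 6,
    (fun j => a + δ * j)^[6] i = i := by decide

/-- **Every automorphism of the 6-cycle satisfies `τ⁶ = id`.** [folklore] -/
theorem cyc_aut_pow_six {τ : Fin 6 → Fin 6} (hinj : Function.Injective τ) (hadj : ∀ i j, cyc i j → cyc (τ i) (τ j)) (i : Fin 6) :
    τ^[6] i = i := by
  obtain ⟨δ, hδ, hτ⟩ := cyc_aut_affine hinj hadj
  have : τ = fun j => τ 0 + δ * j := funext hτ
  rw [this]
  exact affine_pow_six (τ 0) δ hδ i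

/-! ## §3 No `D₄` planar skeleton on `𝕋 □ ℤ` -/

/-- `R⁶ z = −z` for the quarter-turn (`R² = −1`). [folklore] -/
theorem sp_rot_pow_six (z : Site 2) : (sp rot)^[6] z = -z := by
  simp only [Function.iterate_succ, Function.iterate_zero, Function.comp_apply, id_eq, sp_rot_sp_rot, neg_neg]

/-- **THEOREM (row 24): `𝕋 □ ℤ` carries NO `PlanarSkeletonConc`, for any skeleton map.** [cite: KozmaNitzan2024, §4 p. 15–16]
[cite: BenjaminiSchramm1996, Conj. 4] -/
theorem isEmpty_planarSkeletonConc_dgGraph : IsEmpty (PlanarSkeletonConc dgGraph) := by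
  refine ⟨fun Φ => ?_⟩
  obtain ⟨t, ht, -⟩ := Φ.frame (0 : Site 3)
  obtain ⟨α, hαt, hα⟩ := Φ.point t ht rot
  -- the generator permutation at `t` and the displacement map
  set σ : Site 3 → Site 3 := fun s => α (t + s) - t with hσ
  set d : Site 3 → Site 2 := fun s => Φ.φ (t + s) - Φ.φ t with hd
  have hσt : ∀ s, α (t + s) = t + σ s := fun s => by simp [hσ]
  have hkey : ∀ s, d (σ s) = sp rot (d s) := fun s => by
    show Φ.φ (t + σ s) - Φ.φ t = sp rot (Φ.φ (t + s) - Φ.φ t)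
    rw [← hσt]; exact hα (t + s)
  have hkeyn : ∀ n s, d (σ^[n] s) = (sp rot)^[n] (d s) := by
    intro n; induction n with
    | zero => intro s; rfl
    | succ n ih => intro s; rw [Function.iterate_succ_apply', Function.iterate_succ_apply', hkey, ih]
  have hσmem : ∀ s ∈ dgGens, σ s ∈ dgGens := fun s hs => by
    have := (dgGraph_adj_iff _ _).1 (α.map_adj_iff.2 ((dg_adj_add_iff t s).2 hs))
    rwa [hαt] at this
  have hσinj : Function.Injective σ := fun s s' h => by
    have : α (t + s) = α (t + s') := by rw [hσt, hσt, h]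
    exact add_left_cancel (α.injective this)
  -- `σ` keeps the hexagon (non-`e₁` type is preserved: common neighbours)
  have hσT : ∀ s ∈ dgGens, s ≠ ev 1 → s ≠ -ev 1 → σ s ≠ ev 1 ∧ σ s ≠ -ev 1 := by
    intro s hs h1 h2
    have hc : HasCommon t (t + s) := (hasCommon_add_iff t s).2 (dgGens_common_of_ne_e1 s hs h1 h2)
    have hc' : HasCommon (α t) (α (t + s)) := by
      obtain ⟨z, hz1, hz2⟩ := hc; exact ⟨α z, α.map_adj_iff.2 hz1, α.map_adj_iff.2 hz2⟩
    rw [hαt, hσt] at hc'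
    constructor <;> intro h <;> refine not_hasCommon_e1 t (d := σ s) ?_ hc'
    · exact Or.inl h
    · exact Or.inr h
  -- the induced map on the cycle indices
  let τ : Fin 6 → Fin 6 := fun i => idx (σ (hex i))
  have hτ : ∀ i, hex (τ i) = σ (hex i) := by
    intro i
    have hne := hσT (hex i) (hex_mem i) (by decide +revert) (by decide +revert)
    obtain ⟨j, hj⟩ := exists_hex_eq (σ (hex i)) (hσmem _ (hex_mem i)) hne.1 hne.2
    show hex (idx (σ (hex i))) = σ (hex i)
    rw [← hj, idx_hex]
  have hτinj : Function.Injective τ := fun i j h => by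
    have : σ (hex i) = σ (hex j) := by rw [← hτ, ← hτ, h]
    exact hex_injective (hσinj this)
  have hτadj : ∀ i j, cyc i j → cyc (τ i) (τ j) := by
    intro i j hij
    rw [← hexAdj_iff] at hij ⊢
    rw [hτ, hτ]
    have h1 : dgGraph.Adj (t + hex i) (t + hex j) := by
      rw [dgGraph_adj_iff, show t + hex j - (t + hex i) = hex j - hex i by abel]; exact hij
    have h2 := α.map_adj_iff.2 h1
    rw [hσt, hσt, dgGraph_adj_iff, show t + σ (hex j) - (t + σ (hex i)) = σ (hex j) - σ (hex i) by abel] at h2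
    exact h2
  have hτn : ∀ n i, hex (τ^[n] i) = σ^[n] (hex i) := by
    intro n; induction n with
    | zero => intro i; rfl
    | succ n ih => intro i; rw [Function.iterate_succ_apply', Function.iterate_succ_apply', hτ, ih]
  -- the `step` neighbour with displacement `(1,0)` lies on the hexagon
  obtain ⟨v, hv, hφv⟩ := Φ.step t 0 1
  set s₀ := v - t with hs₀
  have hs₀mem : s₀ ∈ dgGens := (dgGraph_adj_iff _ _).1 hv
  have hds₀ : d s₀ = Pi.single 0 1 := by
    show Φ.φ (t + (v - t)) - Φ.φ t = _; rw [add_sub_cancel, hφv]; simp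
  have hne0 : (Pi.single 0 1 : Site 2) ≠ 0 := by
    intro h; have := congrFun h 0; simp at this
  obtain ⟨hb1, hb2⟩ := φ_base_e1 Φ.toPlanarSkeleton ht
  have hs₀1 : s₀ ≠ ev 1 := by
    intro h
    have : d s₀ = 0 := by show Φ.φ (t + s₀) - Φ.φ t = 0; rw [h, hb1, sub_self]
    exact hne0 (hds₀ ▸ this)
  have hs₀2 : s₀ ≠ -ev 1 := by
    intro h
    have : d s₀ = 0 := by show Φ.φ (t + s₀) - Φ.φ t = 0; rw [h, hb2, sub_self]
    exact hne0 (hds₀ ▸ this)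
  obtain ⟨i₀, hi₀⟩ := exists_hex_eq s₀ hs₀mem hs₀1 hs₀2
  -- `σ⁶ s₀ = s₀` by the cycle, but the displacement turns by `R⁶ = −1`
  have h6 : σ^[6] s₀ = s₀ := by rw [← hi₀, ← hτn, cyc_aut_pow_six hτinj hτadj]
  have : d s₀ = -(d s₀) := by
    have := hkeyn 6 s₀; rwa [h6, sp_rot_pow_six] at this
  exact hne0 (hds₀ ▸ eq_zero_of_eq_neg' this)

end Z3Diag

end Summit.CriticalPhenomena.PercolationContinuityZ3.Theorems.Transplant
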